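import Literature.MathematicalPhysics.QuantumFieldTheory.PlaquetteWeightTwistLocality
import HarnessLib

/-!
# The strong-coupling vortex bound for every `SU(2)` plaquette weight near `1`, and Ito–Seiler 2008 Theorem 2.2 (1)
# for Wilson's `SU(2)` action on symmetric tori (`MainClaimTHooft d β q` at small `|β|`)

Topic `Literature/MathematicalPhysics/QuantumFieldTheory`; vocabulary of `PlaquetteWeightPolymers.lean` (`weightZ`,
`weightPolymerActivity`), `TomboulisConfinementClaim.lean` (namespace `Tomboulis2007`: `wilsonWeight β = exp(β Re tr ·)`,
`su2WilsonVortexRatio`, `MainClaimTHooft`), `TwistedPartitionFunction.lean` (`twistedPartitionFunction`, 't Hooft's twisted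
partition function) and the Kotecký–Preiss layer `Literature.Probability.LatticeModels.{ClusterExpansion, ClusterExpansionKPBound,
AnchoredClusterExpansion}`. THEOREMS ONLY (no definition, no fact).

K. R. Ito, E. Seiler, arXiv:0803.3019 [ItoSeiler2008Further] §2 Theorem 2.2: "Define `F = 1 - Z⁻_Λ/Z_Λ` [the vortex free
energy]. (1) Let `G = U(1)` or `G = SU(2)`. Then there is a `β₁ > 0` such that for `β < β₁`,
`lim_{L₃L₄→∞} F/(L₃L₄) ≤ const·exp[-σL₁L₂]` (area decay law). … (1) is a standard result of the convergent
high-temperature expansion (see for instance [Seiler, LNP 159])"; E. T. Tomboulis, arXiv:0707.2179 [Tomboulis2007Confinement]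
§6.2 (6.10)–(6.14). This file proves the symmetric-torus form for `G = SU(2)` with explicit threshold and constants, as the
special case `w = e^{β Re tr}` of a bound valid for EVERY measurable plaquette weight `w` with `(8(d-1)+1)² e² sup|w - 1| ≤ 1/2`:

* `polymerLogZ_sub_polymerLogZ_vortexSheet_eq_weight` — T07 (6.10) for a general weight (twist locality);
* `sum_norm_truncatedWeight_le_of_large_weight` — KP estimate (4) anchored at one-plaquette polymers: the clusters through a
  polymer with `≥ L²` plaquettes weigh `≤ #plaquettes · e^{-L²}`;
* `one_sub_weightZ_div_le_card_mul_exp`, **`one_sub_weightZ_div_le`** — `1 - Z⁻_w/Z_w ≤ 2·#plaq·e^{-L²} ≤ 2d² L^{d-2} e^{-L²/2}`;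
* `abs_wilsonWeight_sub_one_le` (`sup|e^{β Re tr U} - 1| ≤ 4|β|` for `|β| ≤ 1/2`), `twistedPartitionFunction_negOne_eq_weightZ`,
  `su2WilsonVortexRatio_eq_weightZ_div` — the Wilson bridge;
* **`mainClaimTHooft_of_abs_le (d) (hβ : |β| ≤ 1/(8(8(d-1)+1)² e²)) (q) : MainClaimTHooft d β q`**, `mainClaimTHooft_of_le` —
  IS08 Thm 2.2 (1) for `SU(2)` on `(ℤ/Lℤ)^d`: the 't Hooft electric-flux area-law inequality `1 - Z⁻/Z ≤ 2d² L^{d-2} e^{-L²/2}`,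
  all `L ≥ 2`, all planes, at strong coupling; `wilsonLoop_abs_le_of_abs_le` — with the tree's Tomboulis–Yaffe step
  `MainClaimTHooft.wilsonLoop_abs_le`, the Wilson-loop area-law bound at strong coupling through the vortex free energy (T07 (6.4)).

HONEST FRAMING: a strong-coupling (small `|β|`) theorem with a crude explicit radius; the printed statement concerns
asymmetric tori `L₃L₄ → ∞` (TODO(general form), as on `StrongCouplingTwistBound`); nothing here bears on Tomboulis's claim
at large `β`, which Ito–Seiler dispute, nor on any continuum limit.
-/

noncomputable section

open MeasureTheory Finset
open scoped BigOperators
open Literature.MathematicalPhysics.QuantumLattice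
open Literature.Probability.LatticeModels (IsRConnected GeomInc Touches)

namespace Literature.MathematicalPhysics.QuantumFieldTheory

namespace Tomboulis2007

variable {d L : ℕ}

/-! ## Generic weight — the vortex free-energy bound; Wilson's action at strong coupling (IS08 Thm 2.2 (1)) -/

section WeightVortexBound

variable [NeZero L]

open Literature.Probability.LatticeModels

/-- Covering bound (plumbing). [folklore] -/
private theorem sum_le_sum_sum_of_cover' {ι κ : Type*} [DecidableEq ι] (𝒞 : Finset ι) (P : Finset κ)
    (S : κ → Finset ι) {g : ι → ℝ} (hg : ∀ C, 0 ≤ g C) (hcover : ∀ C ∈ 𝒞, ∃ p ∈ P, C ∈ S p) :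
    ∑ C ∈ 𝒞, g C ≤ ∑ p ∈ P, ∑ C ∈ S p, g C := by
  classical
  calc ∑ C ∈ 𝒞, g C ≤ ∑ C ∈ 𝒞, ∑ p ∈ P with C ∈ S p, g C := by
        refine Finset.sum_le_sum fun C hC => ?_
        obtain ⟨p, hp, hR⟩ := hcover C hC
        rw [Finset.sum_const, nsmul_eq_mul]
        have h1 : (1 : ℝ) ≤ (P.filter fun p => C ∈ S p).card := by
          exact_mod_cast Finset.card_pos.2 ⟨p, Finset.mem_filter.2 ⟨hp, hR⟩⟩
        nlinarith [hg C]
    _ = ∑ p ∈ P, ∑ C ∈ 𝒞 with C ∈ S p, g C := by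
        rw [Finset.sum_comm' (t' := P) (s' := fun p => 𝒞.filter fun C => C ∈ S p)]
        intro C p
        simp only [Finset.mem_filter]
        tauto
    _ ≤ ∑ p ∈ P, ∑ C ∈ S p, g C := Finset.sum_le_sum fun p _ =>
        Finset.sum_le_sum_of_subset_of_nonneg (fun C hC => (Finset.mem_filter.1 hC).2) fun C _ _ => hg C

/-- **(6.10) for a general weight**: the Kotecký–Preiss logarithms of `Z⁻` and `Z` differ only by the truncated
functionals of clusters containing a polymer with at least `L²` plaquettes. [cite: Tomboulis2007Confinement, §6.2 eq. (6.10)] -/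
theorem polymerLogZ_sub_polymerLogZ_vortexSheet_eq_weight {w : SU2 → ℝ} (hw : Measurable w) {ε : ℝ}
    (hε : ∀ W, |w W - 1| ≤ ε) {i j : Fin d} (hij : i < j) :
    polymerLogZ (GeomInc linkRel) (weightPolymerActivity w ∅) (torusPolymers d L) -
        polymerLogZ (GeomInc linkRel) (weightPolymerActivity w (vortexSheet L i j hij)) (torusPolymers d L) =
      ∑ C ∈ (torusPolymers d L).powerset with
          (C ∩ (torusPolymers d L).filter fun X => L ^ 2 ≤ X.card).Nonempty,
        (truncatedWeight (GeomInc linkRel) (weightPolymerActivity w ∅) C -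
          truncatedWeight (GeomInc linkRel) (weightPolymerActivity w (vortexSheet L i j hij)) C) := by
  refine polymerLogZ_sub_eq_sum_filter _ _ fun γ hγ hγT => ?_
  have hlt : γ.card < L ^ 2 := by
    by_contra h
    exact hγT (Finset.mem_filter.2 ⟨hγ, not_lt.1 h⟩)
  exact (weightPolymerActivity_vortexSheet_eq_of_card_lt hw hε hij hlt).symm

/-- The tail estimate for a family of clusters each containing a polymer with `≥ L²` plaquettes (general weight).
[cite: KoteckyPreiss1986, Theorem p. 492, estimate (4)] -/
theorem sum_norm_truncatedWeight_le_of_large_weight {w : SU2 → ℝ} {ε : ℝ} (hε : ∀ W, |w W - 1| ≤ ε)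
    (hsmall : (((8 * (d - 1) : ℕ) : ℝ) + 1) ^ 2 * (Real.exp 2 * ε) ≤ 1 / 2)
    (V : Finset (Plaquette d L)) (𝒞 : Finset (Finset (Finset (Plaquette d L))))
    (hlarge : ∀ C ∈ 𝒞, ∃ X ∈ C, X ∈ torusPolymers d L ∧ L ^ 2 ≤ X.card) :
    ∑ C ∈ 𝒞, ‖truncatedWeight (GeomInc linkRel) (weightPolymerActivity w V) C‖ ≤
      (Fintype.card (Plaquette d L) : ℝ) * Real.exp (-((L : ℝ) ^ 2)) := by
  classical
  haveI : Std.Refl (GeomInc (linkRel (d := d) (L := L))) := ⟨geomInc_refl _⟩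
  haveI : Std.Symm (GeomInc (linkRel (d := d) (L := L))) := ⟨fun _ _ h => geomInc_symm _ linkRel_symm h⟩
  have hfact := koteckyPreiss_truncatedWeight_bound_holds (GeomInc linkRel) (weightPolymerActivity w V)
    (fun X : Finset (Plaquette d L) => (X.card : ℝ)) (fun X : Finset (Plaquette d L) => (X.card : ℝ))
  have h1 := kp_hypothesis_weightPolymerActivity_tsum hε hsmall V
  have hsize : ∀ C ∈ 𝒞, ((L : ℝ) ^ 2) ≤ ∑ γ' ∈ C, ((γ'.card : ℕ) : ℝ) := by
    intro C hC
    obtain ⟨X, hXC, -, hXL⟩ := hlarge C hC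
    have h := Finset.single_le_sum (f := fun γ' : Finset (Plaquette d L) => ((γ'.card : ℕ) : ℝ))
      (fun γ' _ => Nat.cast_nonneg _) hXC
    exact le_trans (by exact_mod_cast hXL) h
  have hstep := fun p : Plaquette d L => sum_norm_truncatedWeight_le_exp_neg_of_touches hfact
    (fun _ => Nat.cast_nonneg _) (fun _ => Nat.cast_nonneg _) h1 𝒞 {p} (r := (L : ℝ) ^ 2)
    (fun C hC _ => hsize C hC)
  have hsum := Finset.sum_le_sum fun p (_ : p ∈ (Finset.univ : Finset (Plaquette d L))) => hstep p
  refine ((sum_le_sum_sum_of_cover' 𝒞 Finset.univ _ (fun C => norm_nonneg _) ?_).trans hsum).trans (le_of_eq ?_)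
  · intro C hC
    obtain ⟨X, hXC, hXP, -⟩ := hlarge C hC
    obtain ⟨p, hp⟩ := nonempty_of_mem_torusPolymers hXP
    exact ⟨p, Finset.mem_univ _, Finset.mem_filter.2
      ⟨hC, X, hXC, Or.inr ⟨p, hp, p, Finset.mem_singleton_self p, Or.inl rfl⟩⟩⟩
  · simp only [Finset.card_singleton, Nat.cast_one, mul_one, Finset.sum_const, Finset.card_univ, nsmul_eq_mul]

/-- **The vortex free-energy bound for a general weight, raw form**: `1 - Z⁻_w/Z_w ≤ 2 · #plaquettes · e^{-L²}` inside the
explicit Kotecký–Preiss region `(8(d-1)+1)² e² sup|w - 1| ≤ 1/2`, on every symmetric torus, for every plane.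
[cite: Tomboulis2007Confinement, §6.2 eqs. (6.10)–(6.12)] [cite: ItoSeiler2008Further, §2 Thm 2.2 (1)] -/
theorem one_sub_weightZ_div_le_card_mul_exp {w : SU2 → ℝ} (hw : Measurable w) {ε : ℝ} (hε : ∀ W, |w W - 1| ≤ ε)
    (hsmall : (((8 * (d - 1) : ℕ) : ℝ) + 1) ^ 2 * (Real.exp 2 * ε) ≤ 1 / 2) {i j : Fin d} (hij : i < j) :
    1 - weightZ d L w (vortexSheet L i j hij) / weightZ d L w ∅ ≤
      2 * (Fintype.card (Plaquette d L) : ℝ) * Real.exp (-((L : ℝ) ^ 2)) := by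
  have h1 := eps_lt_one_of_kp (d := d) hε hsmall
  have hZ := weightZ_pos (d := d) (L := L) hw hε h1 ∅
  have hZtw := weightZ_pos (d := d) (L := L) hw hε h1 (vortexSheet L i j hij)
  have hratio : 0 < weightZ d L w (vortexSheet L i j hij) / weightZ d L w ∅ := div_pos hZtw hZ
  set ℓ₀ := polymerLogZ (GeomInc linkRel) (weightPolymerActivity w ∅) (torusPolymers d L) with hℓ₀
  set ℓ₁ := polymerLogZ (GeomInc linkRel) (weightPolymerActivity w (vortexSheet L i j hij)) (torusPolymers d L) with hℓ₁
  have hlogZ : Real.log (weightZ d L w ∅) = ℓ₀.re := log_weightZ_eq_re_polymerLogZ hw hε hsmall ∅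
  have hlogZtw : Real.log (weightZ d L w (vortexSheet L i j hij)) = ℓ₁.re :=
    log_weightZ_eq_re_polymerLogZ hw hε hsmall _
  calc 1 - weightZ d L w (vortexSheet L i j hij) / weightZ d L w ∅
      ≤ -Real.log (weightZ d L w (vortexSheet L i j hij) / weightZ d L w ∅) := by
        linarith [Real.log_le_sub_one_of_pos hratio]
    _ = Real.log (weightZ d L w ∅) - Real.log (weightZ d L w (vortexSheet L i j hij)) := by
        rw [Real.log_div hZtw.ne' hZ.ne']
        ring
    _ = (ℓ₀ - ℓ₁).re := by rw [Complex.sub_re, hlogZ, hlogZtw]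
    _ ≤ ‖ℓ₀ - ℓ₁‖ := Complex.re_le_norm _
    _ = ‖∑ C ∈ (torusPolymers d L).powerset with
            (C ∩ (torusPolymers d L).filter fun X => L ^ 2 ≤ X.card).Nonempty,
          (truncatedWeight (GeomInc linkRel) (weightPolymerActivity w ∅) C -
            truncatedWeight (GeomInc linkRel) (weightPolymerActivity w (vortexSheet L i j hij)) C)‖ := by
        rw [hℓ₀, hℓ₁, polymerLogZ_sub_polymerLogZ_vortexSheet_eq_weight hw hε hij]
    _ ≤ ∑ C ∈ (torusPolymers d L).powerset with
            (C ∩ (torusPolymers d L).filter fun X => L ^ 2 ≤ X.card).Nonempty,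
          (‖truncatedWeight (GeomInc linkRel) (weightPolymerActivity w ∅) C‖ +
            ‖truncatedWeight (GeomInc linkRel) (weightPolymerActivity w (vortexSheet L i j hij)) C‖) :=
        (norm_sum_le _ _).trans (Finset.sum_le_sum fun C _ => norm_sub_le _ _)
    _ ≤ (Fintype.card (Plaquette d L) : ℝ) * Real.exp (-((L : ℝ) ^ 2)) +
          (Fintype.card (Plaquette d L) : ℝ) * Real.exp (-((L : ℝ) ^ 2)) := by
        rw [Finset.sum_add_distrib]
        have hl : ∀ C ∈ (torusPolymers d L).powerset.filter (fun C =>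
            (C ∩ (torusPolymers d L).filter fun X => L ^ 2 ≤ X.card).Nonempty),
            ∃ X ∈ C, X ∈ torusPolymers d L ∧ L ^ 2 ≤ X.card := by
          intro C hC
          obtain ⟨X, hX⟩ := (Finset.mem_filter.1 hC).2
          rw [Finset.mem_inter, Finset.mem_filter] at hX
          exact ⟨X, hX.1, hX.2.1, hX.2.2⟩
        exact add_le_add (sum_norm_truncatedWeight_le_of_large_weight hε hsmall ∅ _ hl)
          (sum_norm_truncatedWeight_le_of_large_weight hε hsmall (vortexSheet L i j hij) _ hl)
    _ = 2 * (Fintype.card (Plaquette d L) : ℝ) * Real.exp (-((L : ℝ) ^ 2)) := by ring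

/-- `#plaquettes ≤ d² L^d` (plumbing). [folklore] -/
private theorem card_plaquette_le' : (Fintype.card (Plaquette d L) : ℝ) ≤ (d : ℝ) ^ 2 * (L : ℝ) ^ d := by
  classical
  have h : Fintype.card (Plaquette d L) ≤ d ^ 2 * L ^ d := by
    rw [Fintype.card_prod]
    have hS : Fintype.card (Site d L) = L ^ d := by
      rw [Fintype.card_pi, Finset.prod_const, ZMod.card, Finset.card_univ, Fintype.card_fin]
    have hP : Fintype.card {p : Fin d × Fin d // p.1 < p.2} ≤ d ^ 2 := by
      refine (Fintype.card_subtype_le _).trans ?_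
      rw [Fintype.card_prod, Fintype.card_fin, sq]
    rw [hS, mul_comm]
    exact Nat.mul_le_mul_right _ hP
  exact_mod_cast h

omit [NeZero L] in
/-- `x ≤ e^{x/2}` for `x ≥ 0` (plumbing). [folklore] -/
private theorem le_exp_half' {x : ℝ} (hx : 0 ≤ x) : x ≤ Real.exp (x / 2) := by
  have h := Real.add_one_le_exp (x / 4)
  have h2 : Real.exp (x / 2) = Real.exp (x / 4) ^ 2 := by
    rw [← Real.exp_nat_mul]; ring_nf
  rw [h2]
  nlinarith [sq_nonneg (1 - x / 4), Real.exp_pos (x / 4)]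

omit [NeZero L] in
/-- `L^d e^{-L²} ≤ L^{d-2} e^{-L²/2}` for `d ≥ 2` (plumbing). [folklore] -/
private theorem pow_mul_exp_neg_sq_le' (hd : 2 ≤ d) (L : ℕ) :
    (L : ℝ) ^ d * Real.exp (-((L : ℝ) ^ 2)) ≤ (L : ℝ) ^ (d - 2) * Real.exp (-(1 / 2 * (L : ℝ) ^ 2)) := by
  have hL2 : (0 : ℝ) ≤ (L : ℝ) ^ 2 := by positivity
  have hx := le_exp_half' hL2
  have hsplit : (L : ℝ) ^ d = (L : ℝ) ^ (d - 2) * (L : ℝ) ^ 2 := by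
    rw [← pow_add, Nat.sub_add_cancel hd]
  have hexp : Real.exp (-((L : ℝ) ^ 2)) = Real.exp (-(1 / 2 * (L : ℝ) ^ 2)) * Real.exp (-((L : ℝ) ^ 2 / 2)) := by
    rw [← Real.exp_add]; ring_nf
  rw [hsplit, hexp]
  have hkey : (L : ℝ) ^ 2 * Real.exp (-((L : ℝ) ^ 2 / 2)) ≤ 1 := by
    rw [Real.exp_neg]
    have hpos := Real.exp_pos ((L : ℝ) ^ 2 / 2)
    rw [mul_inv_le_iff₀ hpos, one_mul]
    exact hx
  have hnn : 0 ≤ (L : ℝ) ^ (d - 2) * Real.exp (-(1 / 2 * (L : ℝ) ^ 2)) := by positivity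
  calc (L : ℝ) ^ (d - 2) * (L : ℝ) ^ 2 * (Real.exp (-(1 / 2 * (L : ℝ) ^ 2)) * Real.exp (-((L : ℝ) ^ 2 / 2)))
      = ((L : ℝ) ^ (d - 2) * Real.exp (-(1 / 2 * (L : ℝ) ^ 2))) * ((L : ℝ) ^ 2 * Real.exp (-((L : ℝ) ^ 2 / 2))) := by
        ring
    _ ≤ ((L : ℝ) ^ (d - 2) * Real.exp (-(1 / 2 * (L : ℝ) ^ 2))) * 1 := mul_le_mul_of_nonneg_left hkey hnn
    _ = (L : ℝ) ^ (d - 2) * Real.exp (-(1 / 2 * (L : ℝ) ^ 2)) := mul_one _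

/-- **The strong-coupling vortex bound for EVERY plaquette weight near `1`** (measurable `w : SU(2) → ℝ` with
`(8(d-1)+1)² e² sup|w - 1| ≤ 1/2`; no class-function, positivity-of-coefficients or character-truncation assumption):
on every symmetric torus `(ℤ/Lℤ)^d` and every plane, `1 - Z⁻_w/Z_w ≤ 2 d² L^{d-2} e^{-L²/2}` — the 't Hooft electric-flux
area-law inequality with `σ = 1/2`, `C = 2d²` (arXiv:0707.2179 §6.2; IS08 Thm 2.2 (1); Osterwalder–Seiler 1978 §3: the
expansion uses only the smallness of the activities). [cite: Tomboulis2007Confinement, §6.2 eqs. (6.10)–(6.14)] [cite: ItoSeiler2008Further, §2 Thm 2.2 (1)] -/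
theorem one_sub_weightZ_div_le {w : SU2 → ℝ} (hw : Measurable w) {ε : ℝ} (hε : ∀ W, |w W - 1| ≤ ε)
    (hsmall : (((8 * (d - 1) : ℕ) : ℝ) + 1) ^ 2 * (Real.exp 2 * ε) ≤ 1 / 2) {i j : Fin d} (hij : i < j) :
    1 - weightZ d L w (vortexSheet L i j hij) / weightZ d L w ∅ ≤
      2 * (d : ℝ) ^ 2 * (L : ℝ) ^ (d - 2) * Real.exp (-(1 / 2 * (L : ℝ) ^ 2)) := by
  have hd : 2 ≤ d := by
    have hi := i.isLt
    have hj := j.isLt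
    have : (i : ℕ) < j := hij
    omega
  calc 1 - weightZ d L w (vortexSheet L i j hij) / weightZ d L w ∅
      ≤ 2 * (Fintype.card (Plaquette d L) : ℝ) * Real.exp (-((L : ℝ) ^ 2)) :=
        one_sub_weightZ_div_le_card_mul_exp hw hε hsmall hij
    _ ≤ 2 * ((d : ℝ) ^ 2 * (L : ℝ) ^ d) * Real.exp (-((L : ℝ) ^ 2)) :=
        mul_le_mul_of_nonneg_right (mul_le_mul_of_nonneg_left card_plaquette_le' (by norm_num))
          (Real.exp_nonneg _)
    _ = 2 * (d : ℝ) ^ 2 * ((L : ℝ) ^ d * Real.exp (-((L : ℝ) ^ 2))) := by ring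
    _ ≤ 2 * (d : ℝ) ^ 2 * ((L : ℝ) ^ (d - 2) * Real.exp (-(1 / 2 * (L : ℝ) ^ 2))) :=
        mul_le_mul_of_nonneg_left (pow_mul_exp_neg_sq_le' hd L) (by positivity)
    _ = 2 * (d : ℝ) ^ 2 * (L : ℝ) ^ (d - 2) * Real.exp (-(1 / 2 * (L : ℝ) ^ 2)) := by ring

end WeightVortexBound

/-! ### Wilson's `SU(2)` action at strong coupling: Ito–Seiler 2008 Theorem 2.2 (1) on symmetric tori -/

section Wilson

variable [NeZero L]

/-- Wilson's weight `exp(β Re tr U)` is continuous, hence measurable. [cite: ItoSeiler2007Tomboulis, §2 eq. (2.1a)] -/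
theorem measurable_wilsonWeight (β : ℝ) : Measurable (wilsonWeight β) := by
  haveI : SecondCountableTopology SU2 := secondCountableTopology_su2
  have hc : Continuous (wilsonWeight β) := by
    unfold wilsonWeight
    exact Real.continuous_exp.comp (continuous_const.mul
      (Complex.continuous_re.comp ((continuous_subtype_val).matrix_trace)))
  exact hc.measurable

omit [NeZero L] in
/-- `|Re tr U| ≤ 2` on `SU(2)`. [folklore] -/
private theorem abs_re_trace_su2_le (U : SU2) : |((U : Matrix (Fin 2) (Fin 2) ℂ).trace).re| ≤ 2 := by
  have h := Literature.RepresentationTheory.CompactGroups.CompactGroup.abs_re_trace_le_card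
    (fundamentalRep (Fin 2)) (continuous_fundamentalRep (Fin 2)) U
  rw [fundamentalRep_apply] at h
  simpa using h

omit [NeZero L] in
/-- **`sup |e^{β Re tr U} - 1| ≤ 4|β|` for `|β| ≤ 1/2`**: Wilson's weight is uniformly close to `1` at strong coupling.
[cite: ItoSeiler2008Further, §2 Thm 2.2 (1)] -/
theorem abs_wilsonWeight_sub_one_le {β : ℝ} (hβ : |β| ≤ 1 / 2) (U : SU2) : |wilsonWeight β U - 1| ≤ 4 * |β| := by
  unfold wilsonWeight
  have htr := abs_re_trace_su2_le U
  have hx : |β * ((U : Matrix (Fin 2) (Fin 2) ℂ).trace).re| ≤ 2 * |β| := by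
    rw [abs_mul]
    nlinarith [abs_nonneg β]
  have hx1 : |β * ((U : Matrix (Fin 2) (Fin 2) ℂ).trace).re| ≤ 1 := by linarith
  calc |Real.exp (β * ((U : Matrix (Fin 2) (Fin 2) ℂ).trace).re) - 1|
      ≤ 2 * |β * ((U : Matrix (Fin 2) (Fin 2) ℂ).trace).re| := Real.abs_exp_sub_one_le hx1
    _ ≤ 4 * |β| := by linarith

/-- Pointwise form of the Wilson Gibbs factor with insertions: `exp(-β Σ_p (2 - Re tr(t_p U_p))) =
e^{-2β#plaq} ∏_p exp(β Re tr(t_p U_p))` (plumbing). [folklore] -/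
private theorem exp_neg_mul_sum_eq_pow_mul_prod (β : ℝ) (t : Plaquette d L → ℝ) :
    Real.exp (-(β * ∑ p : Plaquette d L, ((2 : ℕ) - t p : ℝ))) =
      Real.exp (-(β * 2)) ^ Fintype.card (Plaquette d L) * ∏ p : Plaquette d L, Real.exp (β * t p) := by
  rw [Finset.mul_sum, ← Finset.sum_neg_distrib, Real.exp_sum, ← Finset.card_univ, ← Finset.prod_const,
    ← Finset.prod_mul_distrib]
  refine Finset.prod_congr rfl fun p _ => ?_
  rw [← Real.exp_add]
  congr 1
  push_cast
  ring

/-- **'t Hooft's twisted partition function of Wilson's `SU(2)` action is `e^{-2β#plaquettes} · Z^{(𝒱)}_{w_β}`** with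
`w_β = exp(β Re tr ·)` and the twist set the vortex sheet (`twistedPartitionFunction` of `TwistedPartitionFunction.lean`
vs `weightZ`). [cite: Tomboulis2007Confinement, §4 eqs. (4.1)–(4.3)] -/
theorem twistedPartitionFunction_negOne_eq_weightZ (β : ℝ) {i j : Fin d} (hij : i < j) :
    twistedPartitionFunction (fundamentalRep (Fin 2)) β L negOne ⟨(i, j), hij⟩ =
      Real.exp (-(β * 2)) ^ Fintype.card (Plaquette d L) * weightZ d L (wilsonWeight β) (vortexSheet L i j hij) := by
  unfold twistedPartitionFunction weightZ
  rw [← integral_const_mul]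
  congr 1
  funext U
  rw [exp_neg_mul_sum_eq_pow_mul_prod]
  congr 1
  refine Finset.prod_congr rfl fun p _ => ?_
  have hmem : p ∈ vortexSheet L i j hij ↔ (p.2 = ⟨(i, j), hij⟩ ∧ p.1 i = 0 ∧ p.1 j = 0) := by
    simp [vortexSheet]
  unfold wilsonWeight
  by_cases hp : p.2 = ⟨(i, j), hij⟩ ∧ p.1 i = 0 ∧ p.1 j = 0
  · rw [if_pos hp, if_pos (hmem.2 hp), fundamentalRep_apply]
  · rw [if_neg hp, if_neg (fun h => hp (hmem.1 h)), one_mul, fundamentalRep_apply]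

/-- The untwisted one: `Z_{β,L}(𝟙) = e^{-2β#plaquettes} · Z_{w_β}`. [cite: Tomboulis2007Confinement, §4 eqs. (4.1)–(4.3)] -/
theorem twistedPartitionFunction_one_eq_weightZ (β : ℝ) {i j : Fin d} (hij : i < j) :
    twistedPartitionFunction (fundamentalRep (Fin 2)) β L 1 ⟨(i, j), hij⟩ =
      Real.exp (-(β * 2)) ^ Fintype.card (Plaquette d L) * weightZ d L (wilsonWeight β) ∅ := by
  unfold twistedPartitionFunction weightZ
  rw [← integral_const_mul]
  congr 1
  funext U
  rw [exp_neg_mul_sum_eq_pow_mul_prod]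
  congr 1
  refine Finset.prod_congr rfl fun p _ => ?_
  unfold wilsonWeight
  rw [ite_self, one_mul, if_neg (Finset.notMem_empty p), fundamentalRep_apply]

/-- **The `SU(2)` Wilson vortex ratio is the weight vortex ratio**: `Z⁻_{β,L}/Z_{β,L} = Z^{(𝒱)}_{w_β}/Z_{w_β}`.
[cite: Tomboulis2007Confinement, §6.1 eq. (6.1)] -/
theorem su2WilsonVortexRatio_eq_weightZ_div (β : ℝ) {i j : Fin d} (hij : i < j) :
    su2WilsonVortexRatio L β ⟨(i, j), hij⟩ =
      weightZ d L (wilsonWeight β) (vortexSheet L i j hij) / weightZ d L (wilsonWeight β) ∅ := by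
  unfold su2WilsonVortexRatio
  rw [twistedPartitionFunction_negOne_eq_weightZ, twistedPartitionFunction_one_eq_weightZ β hij]
  have hpos : 0 < Real.exp (-(β * 2)) ^ Fintype.card (Plaquette d L) := pow_pos (Real.exp_pos _) _
  rw [mul_div_mul_left _ _ hpos.ne']

end Wilson

/-- **Ito–Seiler 2008, Theorem 2.2 (1) for `G = SU(2)`, on the symmetric tori** (arXiv:0803.3019 §2 Thm 2.2 (1): "Let
`G = U(1)` or `G = SU(2)`. Then there is a `β₁ > 0` such that for `β < β₁` [the vortex free energy obeys the] (area
decay law) … (1) is a standard result of the convergent high-temperature expansion"; here in the tree's 't Hooft form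
`MainClaimTHooft` on `(ℤ/Lℤ)^d`, with the explicit threshold `|β| ≤ β₁(d) = 1/(8 (8(d-1)+1)² e²)` and constants `σ = 1/2`,
`C = 2d²`): for such `β` and every plane `q`, `1 - Z⁻_{β,L}(q)/Z_{β,L}(q) ≤ 2d² L^{d-2} e^{-L²/2}` for all `L ≥ 2`.
In particular the predicate `MainClaimTHooft d β q` of `TomboulisConfinementClaim.lean` (claimed by T07 for all `β`,
disputed at large `β`) is a THEOREM at strong coupling, as its docstring anticipates. TODO(general form): the printed
statement is for `L₃L₄ → ∞` at fixed `L₁L₂` (asymmetric tori). [cite: ItoSeiler2008Further, §2 Thm 2.2 (1)] [cite: Tomboulis2007Confinement, §6.2 eqs. (6.10)–(6.14)] -/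
theorem mainClaimTHooft_of_abs_le (d : ℕ) {β : ℝ}
    (hβ : |β| ≤ 1 / (8 * ((((8 * (d - 1) : ℕ) : ℝ) + 1) ^ 2 * Real.exp 2)))
    (q : {p : Fin d × Fin d // p.1 < p.2}) : MainClaimTHooft d β q := by
  have hK : (1 : ℝ) ≤ (((8 * (d - 1) : ℕ) : ℝ) + 1) ^ 2 * Real.exp 2 := by
    have hD : (1 : ℝ) ≤ (((8 * (d - 1) : ℕ) : ℝ) + 1) ^ 2 := by
      have : (0 : ℝ) ≤ ((8 * (d - 1) : ℕ) : ℝ) := Nat.cast_nonneg _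
      nlinarith
    have he : (1 : ℝ) ≤ Real.exp 2 := Real.one_le_exp (by norm_num)
    nlinarith
  have hKpos : (0 : ℝ) < (((8 * (d - 1) : ℕ) : ℝ) + 1) ^ 2 * Real.exp 2 := by positivity
  have hβ' : |β| * (8 * ((((8 * (d - 1) : ℕ) : ℝ) + 1) ^ 2 * Real.exp 2)) ≤ 1 := by
    rwa [le_div_iff₀ (by positivity)] at hβ
  have hβhalf : |β| ≤ 1 / 2 := by
    have : |β| * 8 ≤ |β| * (8 * ((((8 * (d - 1) : ℕ) : ℝ) + 1) ^ 2 * Real.exp 2)) := by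
      nlinarith [abs_nonneg β]
    linarith
  have hε : ∀ W : SU2, |wilsonWeight β W - 1| ≤ 4 * |β| := abs_wilsonWeight_sub_one_le hβhalf
  have hsmall : (((8 * (d - 1) : ℕ) : ℝ) + 1) ^ 2 * (Real.exp 2 * (4 * |β|)) ≤ 1 / 2 := by
    nlinarith [abs_nonneg β]
  refine ⟨1 / 2, by norm_num, 2 * (d : ℝ) ^ 2, fun L _ _ => ?_⟩
  obtain ⟨⟨i, j⟩, hij⟩ := q
  rw [su2WilsonVortexRatio_eq_weightZ_div β hij]
  exact one_sub_weightZ_div_le (measurable_wilsonWeight β) hε hsmall hij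

/-- **Corollary: `MainClaimTHooft d β q` for all `0 ≤ β ≤ β₁(d)`** (the form quoted by IS08: "for `β < β₁`").
[cite: ItoSeiler2008Further, §2 Thm 2.2 (1)] -/
theorem mainClaimTHooft_of_le (d : ℕ) {β : ℝ} (h0 : 0 ≤ β)
    (hβ : β ≤ 1 / (8 * ((((8 * (d - 1) : ℕ) : ℝ) + 1) ^ 2 * Real.exp 2)))
    (q : {p : Fin d × Fin d // p.1 < p.2}) : MainClaimTHooft d β q :=
  mainClaimTHooft_of_abs_le d (by rwa [abs_of_nonneg h0]) q

/-- **Wilson loops of `SU(2)` at strong coupling obey an area-law bound — via 't Hooft's criterion and the Tomboulis–Yaffe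
inequality** (arXiv:0707.2179 (6.4): "the well-known inequality … which implies area-law for the Wilson loop"; here the
tree's `MainClaimTHooft.wilsonLoop_abs_le` fed with `mainClaimTHooft_of_abs_le`): for `|β| ≤ 1/(8(8(d-1)+1)²e²)` and a plane
`(0, j)`, there are `σ > 0`, `K ≥ 0` with `|⟨W_{h×w}⟩_{β,L}| ≤ 2^{2h/L} (K L^{d-2})^{hw/L²} e^{-σhw}` on every dyadic torus
`L = 2^{n+1}`, dyadic `h, w ≤ L/2`. (The strong-coupling area law itself is classical, Osterwalder–Seiler 1978; this is the
route through the vortex free energy.) [cite: Tomboulis2007Confinement, §6.1 eq. (6.4)] [cite: TomboulisYaffe1985, App. I eq. (A1.9)] -/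
theorem wilsonLoop_abs_le_of_abs_le {d : ℕ} [NeZero d] {β : ℝ}
    (hβ : |β| ≤ 1 / (8 * ((((8 * (d - 1) : ℕ) : ℝ) + 1) ^ 2 * Real.exp 2))) {j : Fin d} (hj : (0 : Fin d) < j) :
    ∃ σ : ℝ, 0 < σ ∧ ∃ K : ℝ, 0 ≤ K ∧ ∀ (n L : ℕ) [NeZero L], L = 2 ^ (n + 1) → ∀ a b : ℕ, a ≤ n → b ≤ n →
      |wilsonExpectation (fundamentalRep (Fin 2)) β
          (wilsonLoop (fundamentalRep (Fin 2)) (0 : Site d L) 0 j (2 ^ a) (2 ^ b))| ≤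
        (2 : ℝ) ^ (((2 * 2 ^ a : ℕ) : ℝ) / L) *
          (K * (L : ℝ) ^ (d - 2)) ^ (((2 ^ a * 2 ^ b : ℕ) : ℝ) / (L : ℝ) ^ 2) *
            Real.exp (-(σ * ((2 ^ a * 2 ^ b : ℕ) : ℝ))) :=
  MainClaimTHooft.wilsonLoop_abs_le hj (mainClaimTHooft_of_abs_le d hβ ⟨(0, j), hj⟩)

end Tomboulis2007

end Literature.MathematicalPhysics.QuantumFieldTheory

end
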